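import Summits.QuantumFields.YangMills.Theorems.BalabanUVNodesN07SectCRegimeOfRecordSmall
import Literature.MathematicalPhysics.QuantumFieldTheory.Balaban1983to89.Node00.BgSchemeOfRecordEL
import HarnessLib

/-!
# N07 — [15] (48) AT THE RECORD: the linearizing transformation `A = T47(A′) = A′ − HD(A′)` turns the LINEAR constraint `Q A′ = B` into print's NONLINEAR one
# `Q A + C(A) = B` — for the record's Sect. C letters (`H♭ := H1OfRecordAtBgFlat`, `C^{𝔰𝔩} := CslOfRecord`), in the small, and at the scheme's fixed point `A′ = 𝒜(V) + 𝔄(V)`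

Cell `pub-ymgap`, width seat `pub-ymgap-dag-n07-w3` (g28), INTENT-2′ ∕ CLAIM-2.  `--kind proof --supports stmt-QuantumFields-27238 --as helper`; count-neutral.  Chart-free `A′`-space
identities (they survive any re-typing of def-Y's chart letters); the positive half of this seat's LOCATED-g28-2 (HOME `pub-ymgap-dag-n07-w3/LOCATED-CHART-T47.g28.md`, evidence #9 on
⟨27238⟩): def-Y's `BgScheme.chart∕chartCfg` present the fixed point as `exp(iη(𝒜 + 𝔄))·U₀`, print's minimiser is `exp(iη·T47(𝒜 + 𝔄))·U₀` ((15), (47), (74)∕(81)); the difference is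
exactly (48), typed here.  [15] = [Balaban1985Variational].

WHAT (kernel, sorry-free, standard axioms; any `N`, any background `U₀`, level `k`; `Q(U₀)` READ ON THE FUNCTIONS = lit's `readFun (phiRec N) _ (wBRec F K k) (QOfRecord F N k U₀) ∘ JetSup.equiv`,
the reading in which (45) `QH₁B = B` is ✓`B11Eq103H1Complex.Q_H1LatticeCLM`).
* §1 ★★ `readFun_Q_T47_add_csl` — **(48) at the record**: under lit's Sect. C regime `Regime H♭ 0 C^{𝔰𝔩} b 0 C₂ c₄ 0 a_C ε_C` and `‖A′‖ < a_C`,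
  `Q(T47 A′) + C^{𝔰𝔩}(T47 A′) = Q A′` (as `β →` matrix functions).  Proof = lit ✓`T47_sub_self` (`T47 A′ − A′ = −H♭(C^{𝔰𝔩}(T47 A′))`, (49)) + (45) for `H♭` (✓`Q_H1LatticeCLM`) + linearity.
  `readFun_Q_T47_of_eq` — hence `Q A′ = B ⟹ Q(T47 A′) + C^{𝔰𝔩}(T47 A′) = B` (print's «(48) … = L^jηQ_jA′ on Λ_j», read with (75) `Q A′ = B`).
* §2 ★★ `exists_eq48_ofRecord_small` — the same for ALL `A′` in a ball, IN THE SMALL at a guarded background: `∃ t₀ > 0, ∀ 0 < a_C ≤ ε_C ≤ t₀, ∀ ‖A′‖ < a_C, (48)` (regime from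
  ✓`exists_sectCRegime_ofRecord`, existential non-uniform constants).
* §3 ★★★ `readFun_Q_T47_sol_add_frakA` — **AT THE SCHEME OF RECORD's FIXED POINT**: under the EL file's hypotheses (a regime of the data, `‖J‖ ≤ j`, `‖𝔄(V)‖ < a𝔄`, the slot-(c) slice letter
  `FrakGSliceTok`) plus a Sect. C regime with `ε₄ + a𝔄 ≤ a_C`: `Q(T47(𝒜(V) + 𝔄(V))) + C^{𝔰𝔩}(T47(𝒜(V) + 𝔄(V))) = B(V)` (`B = BOfRecord`, (20)) — from ✓`bgSchemeOfRecord_Q_chart` (the LINEAR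
  constraint `Q(𝒜 + 𝔄) = Q𝔄`), ✓`Q_H1OfRecordAtBg128` (`Q𝔄 = QH₁B = B`), ✓`bgSchemeOfRecord_sol_spec` (`‖𝒜‖ ≤ ε₄`) and §1.  This is the identity the CURED chart
  `exp(iη·T47(A + 𝔄 V))·U₀` needs for the KNIT token (rng)'s average clause; the remaining bridge «`Ū(expOver U₀ X) = V ⟺ Q X + C(X) = B(V)`» (3e′'s DEFINITION of `COfRecord` as the
  log-defect, log-disc + guard + `C^{𝔰𝔩} = C` on traceless inputs) is NOT typed here.

HONEST LABELS.  By-name algebra over landed letters; every analytic input (the Sect. C regime, the Prop. 6 regime, `FrakGSliceTok`, the radii) is a DISPLAYED hypothesis or comes from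
✓`exists_sectCRegime_ofRecord` with existential constants; nothing of Bałaban's estimates re-derived; the chart letters of `Node00/BackgroundMapOfRecord(Chart)` are NOT touched (def-Y
custody); K0ᴬ ⟨27238⟩ NOT closed; N07 NOT discharged; R4 is the conditional finite-𝕋⁴ rung `BalabanLadder.UV` only; finite torus, fixed `ε` — nothing continuum ∕ OS ∕ Clay.
**The Yang–Mills mass gap is NOT proved by any of this.**  No `sorry`, no `def`, no `instance ∕ notation`; standard axioms.
-/

set_option autoImplicit false

noncomputable section

open scoped Matrix Matrix.Norms.L2Operator InnerProductSpace

namespace Summit.QuantumFields.YangMills.Theorems.N07Eq48AtRecord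

open Literature.MathematicalPhysics.QuantumFieldTheory.Balaban1983to89
open Literature.MathematicalPhysics.QuantumFieldTheory.Balaban1983to89.T4Continuum (T4Family)
open Literature.MathematicalPhysics.QuantumFieldTheory.Balaban1983to89.Node00
open B11Eq103H1Complex (SiteL2K BondL2K readFun funEquiv QFun Q_H1LatticeCLM)
open B11Eq111FrakG (nabla115 jetLinearEquiv jetLinearEquiv_apply)
open B11Eq115Space (NegSize NegSup levWeight JetSup)
open B11Eq174Chart (Regime)
open B11Eq90V0GroupComposed (T47 T47_sub_self)
open Summit.QuantumFields.YangMills.Theorems.N07SectCRegimeOfRecordSmall (exists_sectCRegime_ofRecord)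

section Record

variable (F : T4Family) (N : ℕ) [NeZero N] (K : ℕ) (k : ℕ) (Ω : ℕ → Set (Site (F.P K) 0)) (U₀ : GaugeField (F.P K) 0 (SU N))
  [Fact (0 < (F.L : ℝ))] [Fact (0 < (F.P K).eta k)] [Fact (0 < c0Rec F K k)] [Fact (∀ c, 0 < wBRec F K k c)]
  (levB : PBond (F.P K) k → ℕ) (a : ℝ)
  (hposb : ∀ x, x ≠ 0 → 0 < RCLike.re ⟪x, laplaceAOfRecord F N k U₀ (QOfRecord F N k U₀) (QflatOfRecord F N k) a x⟫_ℂ)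
  (hQ : Function.Surjective (QOfRecord F N k U₀))

/-! ## §1  (48) at the record's Sect. C letters -/

/-- ★★ **[15] (48) AT THE RECORD**: under the Sect. C regime of `(H♭, C^{𝔰𝔩})` and `‖A′‖ < a_C`, the transformed field `A = T47 A′ = A′ − HD(A′)` satisfies
`Q(U₀) A + C^{𝔰𝔩}(A) = Q(U₀) A′` (read on the functions).  Lit ✓`T47_sub_self` ((49): `A − A′ = −H♭ C^{𝔰𝔩}(A)`) + (45) `Q H♭ = 1` (✓`Q_H1LatticeCLM`) + linearity.
[cite: Balaban1985Variational, (48) p.285, (45) p.285, (47)–(49) p.285] -/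
theorem readFun_Q_T47_add_csl {b C₂ c₄ aC εC : ℝ}
    (RC : Regime (H1OfRecordAtBgFlat F N K k Ω U₀ levB a hposb hQ) (0 : Space115Lit F N K k Ω U₀ →L[ℂ] Space115Lit F N K k Ω U₀)
      (CslOfRecord F N K k Ω U₀ levB) b 0 C₂ c₄ 0 aC εC)
    {A' : Space115Lit F N K k Ω U₀} (hA' : ‖A'‖ < aC) :
    readFun (phiRec N) _ (wBRec F K k) (QOfRecord F N k U₀)
        (JetSup.equiv _ _ (nabla115 ((F.P K).eta k) (unitsOfRecord F N U₀))
          (T47 (H1OfRecordAtBgFlat F N K k Ω U₀ levB a hposb hQ) (CslOfRecord F N K k Ω U₀ levB) εC A')) +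
      NegSup.equiv _ _ (CslOfRecord F N K k Ω U₀ levB (T47 (H1OfRecordAtBgFlat F N K k Ω U₀ levB a hposb hQ) (CslOfRecord F N K k Ω U₀ levB) εC A')) =
    readFun (phiRec N) _ (wBRec F K k) (QOfRecord F N k U₀) (JetSup.equiv _ _ (nabla115 ((F.P K).eta k) (unitsOfRecord F N U₀)) A') := by
  set H := H1OfRecordAtBgFlat F N K k Ω U₀ levB a hposb hQ with hH
  set C := CslOfRecord F N K k Ω U₀ levB with hC
  set Y := T47 H C εC A' with hY
  -- (49): `Y − A′ = −H (C Y)`, i.e. `A′ − H (C Y) = Y`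
  have h49 : Y - A' = -H (C Y) := T47_sub_self RC hA'
  have hY' : A' - H (C Y) = Y := by
    have : A' + (Y - A') = Y := by abel
    rw [h49, ← sub_eq_add_neg] at this
    exact this
  -- linearity of the jet reading and of `Q` read on the functions
  have eJ : JetSup.equiv _ _ (nabla115 ((F.P K).eta k) (unitsOfRecord F N U₀)) (A' - H (C Y)) =
      JetSup.equiv _ _ (nabla115 ((F.P K).eta k) (unitsOfRecord F N U₀)) A' -
        JetSup.equiv _ _ (nabla115 ((F.P K).eta k) (unitsOfRecord F N U₀)) (H (C Y)) := by
    have e := map_sub (jetLinearEquiv (F.L : ℝ) ((F.P K).eta k) (bondLevLit F Ω k) (pairLevLit F Ω k) (nabla115 ((F.P K).eta k) (unitsOfRecord F N U₀)))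
      A' (H (C Y))
    simpa only [jetLinearEquiv_apply] using e
  -- (45) for `H♭`: `Q (H♭ Z) = Z`
  have h45 : readFun (phiRec N) _ (wBRec F K k) (QOfRecord F N k U₀)
      (JetSup.equiv _ _ (nabla115 ((F.P K).eta k) (unitsOfRecord F N U₀)) (H (C Y))) = NegSup.equiv _ _ (C Y) :=
    Q_H1LatticeCLM (phiRec N) hposb hQ _ _ (C Y)
  calc readFun (phiRec N) _ (wBRec F K k) (QOfRecord F N k U₀) (JetSup.equiv _ _ (nabla115 ((F.P K).eta k) (unitsOfRecord F N U₀)) Y) +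
        NegSup.equiv _ _ (C Y)
      = readFun (phiRec N) _ (wBRec F K k) (QOfRecord F N k U₀) (JetSup.equiv _ _ (nabla115 ((F.P K).eta k) (unitsOfRecord F N U₀)) (A' - H (C Y))) +
          NegSup.equiv _ _ (C Y) := by rw [hY']
    _ = readFun (phiRec N) _ (wBRec F K k) (QOfRecord F N k U₀) (JetSup.equiv _ _ (nabla115 ((F.P K).eta k) (unitsOfRecord F N U₀)) A') -
          NegSup.equiv _ _ (C Y) + NegSup.equiv _ _ (C Y) := by rw [eJ, map_sub, h45]
    _ = readFun (phiRec N) _ (wBRec F K k) (QOfRecord F N k U₀) (JetSup.equiv _ _ (nabla115 ((F.P K).eta k) (unitsOfRecord F N U₀)) A') :=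
          sub_add_cancel _ _

/-- **(48) read with a constraint value**: if `Q A′ = B` (the LINEAR constraint (75)) then `Q(T47 A′) + C^{𝔰𝔩}(T47 A′) = B` (the NONLINEAR constraint (20)∕(44) for `A = T47 A′`).
[cite: Balaban1985Variational, (48) p.285, (75) p.289, (20) p.281, (44) p.285] -/
theorem readFun_Q_T47_of_eq {b C₂ c₄ aC εC : ℝ}
    (RC : Regime (H1OfRecordAtBgFlat F N K k Ω U₀ levB a hposb hQ) (0 : Space115Lit F N K k Ω U₀ →L[ℂ] Space115Lit F N K k Ω U₀)
      (CslOfRecord F N K k Ω U₀ levB) b 0 C₂ c₄ 0 aC εC)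
    {A' : Space115Lit F N K k Ω U₀} (hA' : ‖A'‖ < aC) {B : PBond (F.P K) k → Matrix (Fin N) (Fin N) ℂ}
    (hB : readFun (phiRec N) _ (wBRec F K k) (QOfRecord F N k U₀) (JetSup.equiv _ _ (nabla115 ((F.P K).eta k) (unitsOfRecord F N U₀)) A') = B) :
    readFun (phiRec N) _ (wBRec F K k) (QOfRecord F N k U₀)
        (JetSup.equiv _ _ (nabla115 ((F.P K).eta k) (unitsOfRecord F N U₀))
          (T47 (H1OfRecordAtBgFlat F N K k Ω U₀ levB a hposb hQ) (CslOfRecord F N K k Ω U₀ levB) εC A')) +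
      NegSup.equiv _ _ (CslOfRecord F N K k Ω U₀ levB (T47 (H1OfRecordAtBgFlat F N K k Ω U₀ levB a hposb hQ) (CslOfRecord F N K k Ω U₀ levB) εC A')) = B := by
  rw [readFun_Q_T47_add_csl F N K k Ω U₀ levB a hposb hQ RC hA', hB]

/-! ## §2  In the small at a guarded background (existential Sect. C constants) -/

/-- ★★ **(48) FOR EVERY SMALL `A′`, IN THE SMALL**: at a guarded background there is `t₀ > 0` such that for all radii `0 < a_C ≤ ε_C ≤ t₀` and all `‖A′‖ < a_C`,
`Q(T47_{ε_C} A′) + C^{𝔰𝔩}(T47_{ε_C} A′) = Q A′` (Sect. C regime from ✓`exists_sectCRegime_ofRecord`; non-uniform constants).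
[cite: Balaban1985Variational, (48) p.285, Prop. 3 p.289, (51)–(54) p.285] -/
theorem exists_eq48_ofRecord_small (hU₀ : SmallBelow (avOfRecord F N K) k U₀) :
    ∃ t₀ > 0, ∀ εC aC : ℝ, 0 < aC → aC ≤ εC → εC ≤ t₀ → ∀ A' : Space115Lit F N K k Ω U₀, ‖A'‖ < aC →
      readFun (phiRec N) _ (wBRec F K k) (QOfRecord F N k U₀)
          (JetSup.equiv _ _ (nabla115 ((F.P K).eta k) (unitsOfRecord F N U₀))
            (T47 (H1OfRecordAtBgFlat F N K k Ω U₀ levB a hposb hQ) (CslOfRecord F N K k Ω U₀ levB) εC A')) +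
        NegSup.equiv _ _ (CslOfRecord F N K k Ω U₀ levB (T47 (H1OfRecordAtBgFlat F N K k Ω U₀ levB a hposb hQ) (CslOfRecord F N K k Ω U₀ levB) εC A')) =
      readFun (phiRec N) _ (wBRec F K k) (QOfRecord F N k U₀) (JetSup.equiv _ _ (nabla115 ((F.P K).eta k) (unitsOfRecord F N U₀)) A') := by
  obtain ⟨b, C₂, c₄, t₀, -, -, -, ht₀, -, hReg⟩ := exists_sectCRegime_ofRecord F N K k Ω U₀ levB a hposb hQ hU₀
  exact ⟨t₀, ht₀, fun εC aC haC hle hε A' hA' => readFun_Q_T47_add_csl F N K k Ω U₀ levB a hposb hQ (hReg εC aC haC hle hε) hA'⟩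

/-! ## §3  At the scheme of record's fixed point `A′ = 𝒜(V) + 𝔄(V)` -/

section Scheme

variable (Gp : SiteL2K ℂ (F.P K).d (fun _ => (F.P K).sitesPerDir 0) (c0Rec F K k) (WRec N) →ₗ[ℂ]
    SiteL2K ℂ (F.P K).d (fun _ => (F.P K).sitesPerDir 0) (c0Rec F K k) (WRec N))
  (Δ2 : BondL2K ℂ (F.P K).d (fun _ => (F.P K).sitesPerDir 0) (c0Rec F K k) (WRec N) →ₗ[ℂ]
    BondL2K ℂ (F.P K).d (fun _ => (F.P K).sitesPerDir 0) (c0Rec F K k) (WRec N))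
  (hposπ : ∀ x, x ≠ 0 → 0 < RCLike.re ⟪x, laplaceAOfRecordAt F N k U₀ (hessOpOfRecord128 F N k U₀ Gp (QflatOfRecord F N k) Δ2)
    (QOfRecord F N k U₀) (QflatOfRecord F N k) a x⟫_ℂ)

omit [NeZero N] [Fact (0 < (F.L : ℝ))] [Fact (0 < (F.P K).eta k)] [Fact (0 < c0Rec F K k)] [Fact (∀ c, 0 < wBRec F K k c)] in
/-- Bookkeeping: `Q` read on the functions is `funEquiv ∘ QFun` (the EL file states (109)∕(20) with `QFun`; (45) is stated with `readFun`).
[cite: Balaban1985Averaging, (18)–(19) p.21 (bookkeeping)] -/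
theorem readFun_eq_funEquiv_QFun (g : B9SectCLatticeCarrier.Bond (F.P K).d (fun _ => (F.P K).sitesPerDir 0) → Matrix (Fin N) (Fin N) ℂ) :
    readFun (phiRec N) _ (wBRec F K k) (QOfRecord F N k U₀) g = funEquiv (phiRec N) (wBRec F K k) (QFun (phiRec N) (QOfRecord F N k U₀) g) := rfl

/-- ★★★ **(48) AT THE FIXED POINT OF THE SCHEME OF RECORD**: with `A′ := 𝒜(V) + 𝔄(V)` (`𝒜 = (bgSchemeOfRecord …).sol`, `𝔄 = H₁B`), under the EL file's hypotheses (a regime of the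
data, `‖J‖ ≤ j`, `‖𝔄(V)‖ < a𝔄`, `FrakGSliceTok`) and a Sect. C regime with `ε₄ + a𝔄 ≤ a_C`:
`Q(T47 A′) + C^{𝔰𝔩}(T47 A′) = B(V)` — the NONLINEAR constraint (20) for print's transformed field `A = A′ − HD(A′)`, from the LINEAR one (✓`bgSchemeOfRecord_Q_chart`: `Q(𝒜 + 𝔄) = Q𝔄`,
✓`Q_H1OfRecordAtBg128`: `Q𝔄 = B`).  [cite: Balaban1985Variational, (48) p.285, (20) p.281, (103) p.293, (109) p.294, Prop. 6 (115)–(116) p.295] -/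
theorem readFun_Q_T47_sol_add_frakA (dom : Set (GaugeField (F.P K) k (SU N))) {εC B₀ C₄ a₃ j a𝔄 ε₄ b C₂ c₄ aC : ℝ}
    (R : Regime (frakGOfRecordAtBg128 F N K k Ω U₀ Gp Δ2 a hposπ hQ) (0 : Space115Lit F N K k Ω U₀ →L[ℂ] Space115Lit F N K k Ω U₀)
      (WOfRecordAt F N K k Ω U₀ levB a hposb hQ εC Gp) B₀ 0 C₄ a₃ j a𝔄 ε₄)
    (hJ : ‖JOfRecordAtBg F N K k Ω U₀‖ ≤ j) {V : GaugeField (F.P K) k (SU N)} (h𝔄 : ‖frakAOfRecordAtBg128 F N K k Ω U₀ levB Gp Δ2 a hposπ hQ V‖ < a𝔄)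
    (h𝔊 : FrakGSliceTok F N K k Ω U₀ Gp Δ2 a hposπ hQ)
    (RC : Regime (H1OfRecordAtBgFlat F N K k Ω U₀ levB a hposb hQ) (0 : Space115Lit F N K k Ω U₀ →L[ℂ] Space115Lit F N K k Ω U₀)
      (CslOfRecord F N K k Ω U₀ levB) b 0 C₂ c₄ 0 aC εC)
    (haC : ε₄ + a𝔄 ≤ aC) :
    readFun (phiRec N) _ (wBRec F K k) (QOfRecord F N k U₀)
        (JetSup.equiv _ _ (nabla115 ((F.P K).eta k) (unitsOfRecord F N U₀))
          (T47 (H1OfRecordAtBgFlat F N K k Ω U₀ levB a hposb hQ) (CslOfRecord F N K k Ω U₀ levB) εC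
            ((bgSchemeOfRecord F N K k Ω U₀ dom levB Gp Δ2 a hposπ hposb hQ εC B₀ C₄ a₃ j a𝔄 ε₄).sol V + frakAOfRecordAtBg128 F N K k Ω U₀ levB Gp Δ2 a hposπ hQ V))) +
      NegSup.equiv _ _ (CslOfRecord F N K k Ω U₀ levB
          (T47 (H1OfRecordAtBgFlat F N K k Ω U₀ levB a hposb hQ) (CslOfRecord F N K k Ω U₀ levB) εC
            ((bgSchemeOfRecord F N K k Ω U₀ dom levB Gp Δ2 a hposπ hposb hQ εC B₀ C₄ a₃ j a𝔄 ε₄).sol V + frakAOfRecordAtBg128 F N K k Ω U₀ levB Gp Δ2 a hposπ hQ V))) =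
    NegSup.equiv _ _ (BOfRecord F N K k U₀ levB V) := by
  -- `‖𝒜(V) + 𝔄(V)‖ < a_C`
  have hsol := (bgSchemeOfRecord_sol_spec F N K k Ω U₀ levB Gp Δ2 a hposπ hposb hQ dom R hJ h𝔄).1
  have hA' : ‖(bgSchemeOfRecord F N K k Ω U₀ dom levB Gp Δ2 a hposπ hposb hQ εC B₀ C₄ a₃ j a𝔄 ε₄).sol V +
      frakAOfRecordAtBg128 F N K k Ω U₀ levB Gp Δ2 a hposπ hQ V‖ < aC :=
    lt_of_lt_of_le (lt_of_le_of_lt (norm_add_le _ _) (by linarith)) haC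
  -- the LINEAR constraint `Q(𝒜 + 𝔄) = Q𝔄 = B`, read on the functions
  have hlin : readFun (phiRec N) _ (wBRec F K k) (QOfRecord F N k U₀)
      (JetSup.equiv _ _ (nabla115 ((F.P K).eta k) (unitsOfRecord F N U₀))
        ((bgSchemeOfRecord F N K k Ω U₀ dom levB Gp Δ2 a hposπ hposb hQ εC B₀ C₄ a₃ j a𝔄 ε₄).sol V + frakAOfRecordAtBg128 F N K k Ω U₀ levB Gp Δ2 a hposπ hQ V)) =
      NegSup.equiv _ _ (BOfRecord F N K k U₀ levB V) := by
    rw [readFun_eq_funEquiv_QFun, bgSchemeOfRecord_Q_chart F N K k Ω U₀ levB Gp Δ2 a hposπ hposb hQ dom R hJ h𝔄 h𝔊, ← readFun_eq_funEquiv_QFun,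
      frakAOfRecordAtBg128_eq]
    exact Q_H1OfRecordAtBg128 F N K k Ω U₀ levB Gp Δ2 a hposπ hQ (BOfRecord F N K k U₀ levB V)
  exact readFun_Q_T47_of_eq F N K k Ω U₀ levB a hposb hQ RC hA' hlin

end Scheme

end Record

end Summit.QuantumFields.YangMills.Theorems.N07Eq48AtRecord

end
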